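import Mathlib
import HarnessLib
import Literature.Analysis.FluidPDE.PartialRegularityHolds
import Literature.Analysis.FluidPDE.SuitableWeakProofs
import Literature.Analysis.FluidPDE.AxisymmetricEuler
import Summits.NavierStokesRegularity.NavierStokesRegularity.Theorems.AxisTwistDoorAveragedConeLiouvilleLidPartialRegularity
import Summits.NavierStokesRegularity.NavierStokesRegularity.Theorems.AxisTwistDoorAveragedConeLiouvilleRadialGap

/-!
# Route `AxisTwistDoor`, crux `AveragedConeLiouville` (stmt-NavierStokesRegularity-26889) — toward replacing the
# Lei–Ren input (programme R2), piece S6a: A REGULAR CYLINDRICAL SHELL OF A SUITABLE WEAK SOLUTION, UP TO THE LID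

For a suitable weak solution `(u, p)` of the unit-viscosity unforced Navier–Stokes system in the unit parabolic ball
`Q(0, 1)` (Albritton–Barker's class `IsSuitableWeakSolutionInBall 1 0 u p` — the class in which the compactness
theorem `SuitableCompactness_holds` delivers its limits), a radius `ρ₀ < 1` and an interval of radii `(α, β)`:

* `exists_regular_shell` — there are `a`, `η > 0` with `α < a − η < a + η < β` such that EVERY point `w = (t, x)`
  with `−ρ₀² ≤ t ≤ 0`, `‖x‖ ≤ ρ₀` and `a − η ≤ |x_h| ≤ a + η` (`|x_h| = cylRadius x`, the distance to the vertical
  axis) is regular: an interior regular point (`IsRegularPoint`, `t < 0`) or a backward-regular lid point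
  (`¬ IsBackwardSingularPoint`, `t = 0`).

Proof: the singular points in the compact box `[−ρ₀², 0] × B̄(0, ρ₀)` — interior ones (complement of the open regular
set, `𝒫¹`-null by the tree's `ckn_partial_regularity_holds`) together with the backward-singular lid points
(`𝒫¹`-null by pieces S1+S2, `isParabolicNull_lidSingularSet_of_inBall`) — form a COMPACT `𝒫¹`-null set (lid limits of
interior singular points are backward-singular), to which piece S3 (`exists_gap_of_isParabolicNull`) applies with the
`1`-Lipschitz function `cylRadius`.

Seat ns-atd-p1 (LEAD g2).  WHAT THIS IS NOT: not a statement about Navier–Stokes regularity (a property of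
HYPOTHETICAL blow-up limits); the crux stays conditional on Lei–Ren 2024 until R2 completes.  Lands `--supports` the
crux item as a helper.
-/

noncomputable section

set_option linter.dupNamespace false

namespace Summit.NavierStokesRegularity.NavierStokesRegularity.Theorems.AveragedConeLiouville.RegularShell

open scoped ENNReal NNReal Topology
open Set Function MeasureTheory Metric Filter
open Literature.Analysis.FluidPDE
open Summit.NavierStokesRegularity.NavierStokesRegularity.Theorems.AveragedConeLiouville.LidPartialRegularity
open Summit.NavierStokesRegularity.NavierStokesRegularity.Theorems.AveragedConeLiouville.RadialGap

/-! ### The distance to the axis is `1`-Lipschitz -/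

/-- The horizontal projection `x ↦ (x₀, x₁) ∈ ℝ²`. -/
theorem cylRadius_eq_norm_proj (x : EuclideanSpace ℝ (Fin 3)) :
    cylRadius x = ‖(WithLp.toLp 2 ![x 0, x 1] : EuclideanSpace ℝ (Fin 2))‖ := by
  rw [cylRadius, EuclideanSpace.norm_eq, Fin.sum_univ_two]
  simp [Real.norm_eq_abs, sq_abs]

/-- The horizontal projection does not increase the norm. -/
theorem norm_proj_le (x : EuclideanSpace ℝ (Fin 3)) :
    ‖(WithLp.toLp 2 ![x 0, x 1] : EuclideanSpace ℝ (Fin 2))‖ ≤ ‖x‖ := by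
  rw [EuclideanSpace.norm_eq, EuclideanSpace.norm_eq x, Fin.sum_univ_two, Fin.sum_univ_three]
  refine Real.sqrt_le_sqrt ?_
  simp only [Matrix.cons_val_zero, Matrix.cons_val_one]
  nlinarith [sq_nonneg ‖x 2‖]

/-- `|cylRadius x − cylRadius y| ≤ ‖x − y‖`: the distance to the vertical axis is `1`-Lipschitz. -/
theorem lipschitzWith_cylRadius : LipschitzWith 1 (cylRadius : EuclideanSpace ℝ (Fin 3) → ℝ) := by
  refine LipschitzWith.of_dist_le_mul fun x y => ?_
  rw [NNReal.coe_one, one_mul, Real.dist_eq, dist_eq_norm, cylRadius_eq_norm_proj, cylRadius_eq_norm_proj]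
  have hsub : (WithLp.toLp 2 ![x 0, x 1] : EuclideanSpace ℝ (Fin 2)) - WithLp.toLp 2 ![y 0, y 1] =
      WithLp.toLp 2 ![(x - y) 0, (x - y) 1] := by
    ext i
    fin_cases i <;> simp
  refine (abs_norm_sub_norm_le _ _).trans ?_
  rw [hsub]
  exact norm_proj_le (x - y)

/-! ### Cylinder inclusions used in the closedness arguments -/

/-- A backward cylinder about a nearby lid point lies in a bigger backward cylinder:
`Q((T, x'), r/2) ⊆ Q((T, x), r)` when `dist x' x < r/2`. -/
theorem parabolicCylinder_half_subset {T r : ℝ} {x x' : EuclideanSpace ℝ (Fin 3)}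
    (hx : dist x' x < r / 2) :
    parabolicCylinder (r / 2) ((T, x') : ℝ × EuclideanSpace ℝ (Fin 3)) ⊆ parabolicCylinder r (T, x) := by
  rintro ⟨t, y⟩ h
  rw [mem_parabolicCylinder] at h ⊢
  obtain ⟨⟨h1, h2⟩, h3⟩ := h
  simp only at h1 h2 h3 ⊢
  refine ⟨⟨by nlinarith, h2⟩, ?_⟩
  calc dist y x ≤ dist y x' + dist x' x := dist_triangle _ _ _
    _ < r / 2 + r / 2 := add_lt_add h3 hx
    _ = r := by ring

/-- A small centred cylinder about an interior point just below a lid point lies in the backward cylinder about the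
lid point: with `s² = −(t' − T)/2`, `T − r²/2 < t' < T`, `dist x' x < r/2`: `Q*_s(t', x') ⊆ Q_r(T, x)`. -/
theorem parabolicCylinderCentered_subset_of_below {T r t' : ℝ} {x x' : EuclideanSpace ℝ (Fin 3)} (hr : 0 < r)
    (ht'1 : T - r ^ 2 / 2 < t') (ht'2 : t' < T) (hx : dist x' x < r / 2) :
    parabolicCylinderCentered (Real.sqrt ((T - t') / 2)) ((t', x') : ℝ × EuclideanSpace ℝ (Fin 3)) ⊆
      parabolicCylinder r (T, x) := by
  have hs2 : Real.sqrt ((T - t') / 2) ^ 2 = (T - t') / 2 := Real.sq_sqrt (by linarith)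
  have hs : Real.sqrt ((T - t') / 2) < r / 2 := by
    rw [show r / 2 = Real.sqrt ((r / 2) ^ 2) by rw [Real.sqrt_sq (by linarith)]]
    exact Real.sqrt_lt_sqrt (by linarith) (by nlinarith)
  rintro ⟨t, y⟩ h
  rw [mem_parabolicCylinderCentered] at h
  rw [mem_parabolicCylinder]
  obtain ⟨⟨h1, h2⟩, h3⟩ := h
  simp only at h1 h2 h3 ⊢
  rw [hs2] at h1 h2
  refine ⟨⟨by nlinarith, by linarith⟩, ?_⟩
  calc dist y x ≤ dist y x' + dist x' x := dist_triangle _ _ _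
    _ < r / 2 + r / 2 := add_lt_add (h3.trans hs) hx
    _ = r := by ring

/-! ### The regular shell -/

/-- **A regular cylindrical shell, up to the lid.**  For `(u, p)` in Albritton–Barker's class on the unit parabolic
ball `Q(0,1)`, a radius `0 < ρ₀ < 1` and an interval of radii `α < β`, there are `a`, `η > 0` with
`α < a − η < a + η < β` such that every point `(t, x)` with `−ρ₀² ≤ t ≤ 0`, `‖x‖ ≤ ρ₀`, `a − η ≤ |x_h| ≤ a + η` is
an interior regular point (`t < 0`) or a backward-regular lid point (`t = 0`). -/
theorem exists_regular_shell {u : ℝ → EuclideanSpace ℝ (Fin 3) → EuclideanSpace ℝ (Fin 3)}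
    {p : ℝ → EuclideanSpace ℝ (Fin 3) → ℝ}
    (hIB : IsSuitableWeakSolutionInBall 1 (0 : ℝ × EuclideanSpace ℝ (Fin 3)) u p) {ρ₀ : ℝ} (hρ₀ : 0 < ρ₀)
    (hρ₀1 : ρ₀ < 1) {α β : ℝ} (hαβ : α < β) :
    ∃ a η : ℝ, 0 < η ∧ α < a - η ∧ a + η < β ∧
      (∀ x : EuclideanSpace ℝ (Fin 3), ‖x‖ ≤ ρ₀ → a - η ≤ cylRadius x → cylRadius x ≤ a + η →
        ¬ IsBackwardSingularPoint u ((0 : ℝ), x)) ∧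
      (∀ w : ℝ × EuclideanSpace ℝ (Fin 3), -ρ₀ ^ 2 ≤ w.1 → w.1 < 0 → ‖w.2‖ ≤ ρ₀ → a - η ≤ cylRadius w.2 →
        cylRadius w.2 ≤ a + η → IsRegularPoint u w) := by
  -- the box, the open unit cylinder and the two singular sets
  set B : Set (ℝ × EuclideanSpace ℝ (Fin 3)) := Icc (-ρ₀ ^ 2) 0 ×ˢ closedBall 0 ρ₀ with hB
  have hBc : IsCompact B := isCompact_Icc.prod (isCompact_closedBall _ _)
  have hBcl : IsClosed B := hBc.isClosed
  set Q₁ : Set (ℝ × EuclideanSpace ℝ (Fin 3)) := parabolicCylinder 1 (0 : ℝ × EuclideanSpace ℝ (Fin 3)) with hQ₁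
  have hBQ : ∀ w ∈ B, w.1 < 0 → w ∈ Q₁ := by
    rintro ⟨t, y⟩ ⟨ht, hy⟩ hneg
    rw [hQ₁, mem_parabolicCylinder]
    simp only [mem_Icc, mem_closedBall, Prod.fst_zero, Prod.snd_zero] at ht hy hneg ⊢
    have hρ2 : ρ₀ ^ 2 < 1 := by nlinarith
    exact ⟨⟨by linarith [ht.1], hneg⟩, lt_of_le_of_lt hy hρ₀1⟩
  set S₁ : Set (ℝ × EuclideanSpace ℝ (Fin 3)) := {w | w ∈ B ∧ w.1 < 0 ∧ ¬ IsRegularPoint u w} with hS₁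
  set S₂ : Set (ℝ × EuclideanSpace ℝ (Fin 3)) :=
    {w | w.1 = 0 ∧ w.2 ∈ closedBall (0 : EuclideanSpace ℝ (Fin 3)) ρ₀ ∧ IsBackwardSingularPoint u w} with hS₂
  -- both are `𝒫¹`-null
  have hS₁null : IsParabolicNull 1 S₁ := by
    have hckn := ckn_partial_regularity_holds (parabolicCylinderOpens 1 (0 : ℝ × EuclideanSpace ℝ (Fin 3)))
      one_pos hIB.1 (isCKNForceOn_zero _)
    refine hckn.mono fun w hw => ?_
    exact ⟨hBQ w hw.1 hw.2.1, hw.2.2⟩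
  have hS₂null : IsParabolicNull 1 S₂ := by
    have h := isParabolicNull_lidSingularSet_of_inBall hIB hρ₀1
    simpa only [Prod.fst_zero, Prod.snd_zero] using h
  have hSnull : IsParabolicNull 1 (S₁ ∪ S₂) := by
    have h := parabolicHausdorff_union_le_holds 1 S₁ S₂
    rw [hS₁null, hS₂null, add_zero] at h
    exact le_antisymm h bot_le
  -- backward regularity at a lid point spreads to nearby lid points and to interior points just below
  have hlid_nbhd : ∀ (x : EuclideanSpace ℝ (Fin 3)) (r : ℝ), 0 < r →
      eLpNorm (uncurry u) ∞ (volume.restrict (parabolicCylinder r (((0 : ℝ), x) : ℝ × EuclideanSpace ℝ (Fin 3)))) ≠ ∞ →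
      (∀ x' : EuclideanSpace ℝ (Fin 3), dist x' x < r / 2 → ¬ IsBackwardSingularPoint u ((0 : ℝ), x')) ∧
      (∀ (t' : ℝ) (x' : EuclideanSpace ℝ (Fin 3)), 0 - r ^ 2 / 2 < t' → t' < 0 → dist x' x < r / 2 →
        IsRegularPoint u (t', x')) := by
    intro x r hr hfin
    refine ⟨fun x' hx' hsing => ?_, fun t' x' ht'1 ht'2 hx' => ?_⟩
    · have h1 := hsing (r / 2) (by positivity)
      have h2 : eLpNorm (uncurry u) ∞ (volume.restrict (parabolicCylinder (r / 2)
          (((0 : ℝ), x') : ℝ × EuclideanSpace ℝ (Fin 3)))) ≤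
          eLpNorm (uncurry u) ∞ (volume.restrict (parabolicCylinder r (((0 : ℝ), x) : ℝ × EuclideanSpace ℝ (Fin 3)))) :=
        eLpNorm_mono_measure _ (Measure.restrict_mono_set _ (parabolicCylinder_half_subset hx'))
      rw [h1] at h2
      exact hfin (top_le_iff.1 h2)
    · refine ⟨Real.sqrt ((0 - t') / 2), Real.sqrt_pos.2 (by linarith), ?_⟩
      have hsub := parabolicCylinderCentered_subset_of_below (T := 0) (x := x) hr ht'1 ht'2 hx'
      exact lt_of_le_of_lt (eLpNorm_mono_measure _ (Measure.restrict_mono_set _ hsub)) (lt_top_iff_ne_top.2 hfin)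
  -- the union is closed
  have hclosed : IsClosed (S₁ ∪ S₂) := by
    refine isClosed_of_closure_subset fun w hw => ?_
    rw [closure_union] at hw
    -- a closure point lies in the closed box `B`
    have hS₁B : S₁ ⊆ B := fun w hw => hw.1
    have hS₂B : S₂ ⊆ B := by
      rintro ⟨t, y⟩ ⟨ht, hy, -⟩
      simp only at ht hy
      refine ⟨?_, hy⟩
      rw [ht]; exact ⟨by nlinarith, le_rfl⟩
    have hwB : w ∈ B := by
      rcases hw with hw | hw
      · exact hBcl.closure_subset_iff.2 hS₁B hw
      · exact hBcl.closure_subset_iff.2 hS₂B hw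
    obtain ⟨⟨hw1, hw2⟩, hwx⟩ := hwB
    -- if `w` is backward-regular at a lid position, derive a contradiction from nearby singular points
    rcases hw with hw | hw
    · -- closure point of the interior singular set
      rcases lt_or_eq_of_le hw2 with hneg | hzero
      · -- interior: the singular set is relatively closed in the open cylinder
        left
        refine ⟨⟨⟨hw1, hw2⟩, hwx⟩, hneg, ?_⟩
        have hsub : S₁ ⊆ singularSet u Q₁ := fun w' hw' => ⟨hBQ w' hw'.1 hw'.2.1, hw'.2.2⟩
        have hmem : w ∈ closure (singularSet u Q₁) ∩ Q₁ :=
          ⟨closure_mono hsub hw, hBQ w ⟨⟨hw1, hw2⟩, hwx⟩ hneg⟩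
        exact (closure_singularSet_inter_subset u Q₁ hmem).2
      · -- on the lid: the point is backward-singular
        right
        refine ⟨hzero, hwx, ?_⟩
        intro r hr
        by_contra hfin
        obtain ⟨-, hbelow⟩ := hlid_nbhd w.2 r hr (by rwa [show (((0 : ℝ), w.2) : ℝ × EuclideanSpace ℝ (Fin 3)) = w from
          Prod.ext hzero.symm rfl])
        -- a point of `S₁` within `min (r²/2) (r/2)` of `w`
        obtain ⟨w', hw'S, hw'd⟩ := Metric.mem_closure_iff.1 hw (min (r ^ 2 / 2) (r / 2)) (by positivity)
        rw [dist_comm, Prod.dist_eq, max_lt_iff, Real.dist_eq] at hw'd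
        obtain ⟨hd1, hd2⟩ := hw'd
        have hd1' : |w'.1 - w.1| < r ^ 2 / 2 := hd1.trans_le (min_le_left _ _)
        have hd2' : dist w'.2 w.2 < r / 2 := hd2.trans_le (min_le_right _ _)
        rw [hzero] at hd1'
        have ht'1 : 0 - r ^ 2 / 2 < w'.1 := by
          have := (abs_lt.1 hd1').1; linarith
        exact hw'S.2.2 (by
          have := hbelow w'.1 w'.2 ht'1 hw'S.2.1 hd2'
          simpa only [Prod.mk.eta] using this)
    · -- closure point of the lid singular set
      right
      have hS₂cl : S₂ ⊆ {w : ℝ × EuclideanSpace ℝ (Fin 3) | w.1 = 0} := fun w hw => hw.1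
      have hzero : w.1 = 0 :=
        (isClosed_eq continuous_fst continuous_const).closure_subset_iff.2 hS₂cl hw
      refine ⟨hzero, hwx, ?_⟩
      intro r hr
      by_contra hfin
      obtain ⟨hnear, -⟩ := hlid_nbhd w.2 r hr (by rwa [show (((0 : ℝ), w.2) : ℝ × EuclideanSpace ℝ (Fin 3)) = w from
        Prod.ext hzero.symm rfl])
      obtain ⟨w', hw'S, hw'd⟩ := Metric.mem_closure_iff.1 hw (r / 2) (by positivity)
      rw [dist_comm, Prod.dist_eq, max_lt_iff] at hw'd
      have : w' = (((0 : ℝ), w'.2) : ℝ × EuclideanSpace ℝ (Fin 3)) := Prod.ext hw'S.1 rfl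
      exact hnear w'.2 hw'd.2 (this ▸ hw'S.2.2)
  have hScomp : IsCompact (S₁ ∪ S₂) := by
    refine hBc.of_isClosed_subset hclosed ?_
    rintro w (hw | hw)
    · exact hw.1
    · obtain ⟨ht, hy, -⟩ := hw
      refine ⟨?_, hy⟩
      rw [ht]; exact ⟨by nlinarith, le_rfl⟩
  -- the gap
  obtain ⟨a, η, hη, h1, h2, hgap⟩ := exists_gap_of_isParabolicNull hScomp hSnull lipschitzWith_cylRadius hαβ
  refine ⟨a, η, hη, h1, h2, fun x hx hr1 hr2 hsing => ?_, fun w hw1 hw2 hwx hr1 hr2 => ?_⟩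
  · have hmem : (((0 : ℝ), x) : ℝ × EuclideanSpace ℝ (Fin 3)) ∈ S₁ ∪ S₂ :=
      Or.inr ⟨rfl, mem_closedBall_zero_iff.2 hx, hsing⟩
    rcases hgap _ hmem with h | h
    · simp only at h; linarith
    · simp only at h; linarith
  · by_contra hreg
    have hmem : w ∈ S₁ ∪ S₂ := Or.inl ⟨⟨⟨hw1, hw2.le⟩, mem_closedBall_zero_iff.2 hwx⟩, hw2, hreg⟩
    rcases hgap _ hmem with h | h
    · linarith
    · linarith

end Summit.NavierStokesRegularity.NavierStokesRegularity.Theorems.AveragedConeLiouville.RegularShell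

end
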